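import Literature.AlgebraicGeometry.GroupSchemes.CartierDualAnnihilatorOfDuality
import Literature.AlgebraicGeometry.GroupSchemes.CartierDualBidualNatural
import Literature.AlgebraicGeometry.GroupSchemes.AffineGroupSchemeIsoSpec
import Literature.AlgebraicGeometry.GroupSchemes.BTGroupFrobeniusKernelInCoordinates
import HarnessLib

/-!
# The double annihilator `(H^⊥)^⊥ = H` under Cartier biduality (Tate 1997 §(3.8); Görtz–Wedhorn I Def. 4.45)

Layer `Literature/AlgebraicGeometry/GroupSchemes`, namespace `Literature.AlgebraicGeometry.GroupSchemes.AffineGroupScheme` (+ one lemma in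
`…GroupSchemes.GroupSchemeKernel`).  Continues ★ `CartierDualAnnihilator` p845459 (`annihilator j = H^⊥ := Ker (j^D)`), ★
`CartierDualAnnihilatorRank` p845797 (`rk H^⊥ · rk H = rk G`), ★ `CartierDualBidualNatural` p845987 (`ε : (G^D)^D ≅ G` is natural), ★
`CartierDualAnnihilatorOfDuality` p845944.  THEOREMS ONLY (no definition, no instance, no notation, no named fact, no `sorry`).  Cell `hodgecm-mathlib`
(D-0151), programme P6 «MOD», HEART organ ST-0′ row **(g3-c)** «double annihilator» (A-p17 (g24) sharpen (iii); LEAD F0P6-plan (g0) M-16 (6); B-p04 (g37)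
(N1) 17:22Z; A-p06 (g30)).  Count-neutral Mathlib-side capital: HC_CM is proved only modulo the 7 printed citations until rung 0 closes; nothing here bears on it.

THE PRINT ([Tate1997FiniteFlatGroupSchemes] §(3.8) p. 145: «`G ≃ (G^D)^D`»; p. 146: duality is exact, so for a closed subgroup `H ⊂ G` one has
`(G⧸H)^D = H^⊥` and dually `H = (H^⊥)^⊥` under `G ≅ (G^D)^D`).  For finite commutative group schemes over a field `k` and a closed subgroup
`j : H ↪ G`:

* §0 generic inputs: the kernel of a homomorphism out of a COMMUTATIVE group object is commutative (`GroupSchemeKernel.isCommMonObj_ker`); the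
  Cartier dual of the TRIVIAL homomorphism is trivial — `isMonHom_one`, `Alg.comap_one` (`Γ(1) = η ∘ ε`), `DualAlg.transpose_one`, **`cartierDualMap_one : (1)^D = 1`**.
* §1 `H^⊥` is a finite commutative group scheme: `isCommMonHom…` — `isCommMonObj_annihilator`, `isFinite_annihilator_hom`, `finite_alg_annihilator`
  (so that `(H^⊥)^⊥ = annihilator (annihilatorι j)` is formed).
* §2 **`comp_cartierDualBidualIso_inv_comp_cartierDualMap_annihilatorι : (j ≫ ε_G⁻¹) ≫ (ι_{H^⊥})^D = 1`** (naturality `j ≫ ε_G⁻¹ = ε_H⁻¹ ≫ (j^D)^D`,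
  `(j^D)^D ≫ ι^D = (ι ≫ j^D)^D = (1)^D = 1`), hence the comparison homomorphism **`H → (H^⊥)^⊥`** over `G ≅ (G^D)^D`
  (`exists_comp_annihilatorι_annihilatorι_eq`).
* §3 HEAD **`exists_iso_annihilator_annihilatorι` — `(H^⊥)^⊥ = ε_G⁻¹(H)`**: for a CLOSED subgroup `j` the comparison map is an ISOMORPHISM of group
  schemes over `(G^D)^D` (ranks: `rk (H^⊥)^⊥ = rk G^D ∕ rk H^⊥ = rk H` by ★ `finrank_alg_annihilator_mul_finrank` twice; two nested closed subschemes of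
  the affine `(G^D)^D` with the same rank coincide, ★ `isIso_of_ker_appTop_eq`).

## References
* [Tate1997FiniteFlatGroupSchemes] J. Tate, *Finite flat group schemes*, in: Modular Forms and Fermat's Last Theorem (1997), §(3.8) pp. 144–146.
* [GortzWedhorn2020] U. Görtz, T. Wedhorn, *Algebraic Geometry I: Schemes*, 2nd ed. (2020), (4.15) Definition 4.45, p. 117.
-/

set_option autoImplicit false

-- Mathlib's `Over`/`Scheme` APIs are stated across semireducible wrappers (as in the ★ `GroupSchemes/*` files).
set_option backward.isDefEq.respectTransparency false

universe v u

open CategoryTheory CategoryTheory.Limits AlgebraicGeometry MonoidalCategory CartesianMonoidalCategory WithConv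

noncomputable section

namespace Literature.AlgebraicGeometry.GroupSchemes

/-! ## §0a The kernel of a homomorphism out of a commutative group object is commutative -/

namespace GroupSchemeKernel

open scoped MonObj

/-- **`Ker f` is commutative when `G` is**: `ι : Ker f → G` is a monomorphic homomorphism into a commutative group object, and commutativity
of the `T`-valued points is inherited along an injective homomorphism (Mathlib `isCommMonObj_iff_isMulCommutative`).
[cite: GortzWedhorn2020, Definition 4.45 (2), p. 117] -/
theorem isCommMonObj_ker {C : Type u} [Category.{v} C] [CartesianMonoidalCategory C] [BraidedCategory C] {G H : C} [GrpObj G] [GrpObj H]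
    [IsCommMonObj G] (f : G ⟶ H) [IsMonHom f] [HasPullback f η[H]] : IsCommMonObj (ker f) := by
  haveI := isMonHom_kerι f
  haveI := mono_kerι f
  rw [isCommMonObj_iff_isMulCommutative]
  intro X
  haveI := (isCommMonObj_iff_isMulCommutative G).1 inferInstance X
  refine ⟨⟨fun a b => ?_⟩⟩
  rw [← cancel_mono (kerι f), MonObj.mul_comp, MonObj.mul_comp, mul_comm]

end GroupSchemeKernel

namespace AffineGroupScheme

open scoped MonObj

open Literature.AlgebraicGeometry.Motives Literature.NumberTheory.DiophantineGeometry Literature.RingTheory.HopfAlgebra GroupSchemeKernel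

/-! ## §0b The Cartier dual of the trivial homomorphism is trivial: `(1)^D = 1` -/

section One

variable {R : Type u} [CommRing R]

/-- The trivial morphism `1 = (X → 𝟙 → Y)` is a homomorphism. [cite: GortzWedhorn2020, Definition 4.45, p. 117] -/
theorem isMonHom_one {X Y : SchemeOver R} [GrpObj X] [GrpObj Y] : IsMonHom (1 : X ⟶ Y) := by
  rw [Hom.one_def]
  infer_instance

/-- **`Γ(1) = η ∘ ε`**: the trivial homomorphism `X → Y` pulls functions back along `Γ(Y) →(ε) R → Γ(X)` (★ `comap_one_eq` for `Γ(η[Y])`, and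
`Γ(X → 𝟙)` is THE `R`-algebra structure map). [cite: GortzWedhorn2023, §(27.2) (27.2.1) and Definition 27.6 (pp. 606–607)] -/
theorem Alg.comap_one {X Y : SchemeOver R} [GrpObj Y] [IsAffine Y.left] :
    Alg.comap (1 : X ⟶ Y) = (Algebra.ofId R (Alg X)).comp (Bialgebra.counitAlgHom R (Alg Y)) := by
  rw [Hom.one_def, Alg.comap_comp, comap_one_eq Y, ← AlgHom.comp_assoc]
  congr 1

variable {X Y : SchemeOver R}
  [GrpObj X] [IsCommMonObj X] [IsAffine X.left] [Module.Free R (Alg X)] [Module.Finite R (Alg X)]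
  [GrpObj Y] [IsCommMonObj Y] [IsAffine Y.left] [Module.Free R (Alg Y)] [Module.Finite R (Alg Y)]

omit [Module.Free R (Alg Y)] [Module.Finite R (Alg Y)] in
/-- **The transpose of `Γ(1)` is `η ∘ ε` on the dual Hopf algebras**: `φ ↦ φ ∘ Γ(1) = φ(1) · ε_Y`. [cite: Tate1997FiniteFlatGroupSchemes, §(3.8) p. 145] -/
theorem DualAlg.transpose_one [IsMonHom (1 : X ⟶ Y)] :
    DualAlg.transpose (1 : X ⟶ Y) = (Algebra.ofId R (DualAlg Y)).comp (Bialgebra.counitAlgHom R (DualAlg X)) := by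
  apply AlgHom.ext
  intro φ
  apply ofConv_injective
  refine LinearMap.ext fun a => ?_
  rw [DualAlg.transpose_apply_apply, Alg.comap_one, AlgHom.comp_apply, Algebra.ofId_apply, Algebra.algebraMap_eq_smul_one, map_smul,
    Bialgebra.counitAlgHom_apply, AlgHom.comp_apply, Algebra.ofId_apply, Bialgebra.counitAlgHom_apply, Algebra.algebraMap_eq_smul_one]
  change _ = WithConv.ofConv (FiniteDual.counit R (Alg X) φ • (1 : DualAlg Y)) a
  rw [FiniteDual.counit_apply, WithConv.ofConv_smul, LinearMap.smul_apply]
  change _ = _ • (1 : WithConv (Module.Dual R (Alg Y))) a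
  rw [convOne_apply_eq_counit, smul_eq_mul, smul_eq_mul, mul_comm]

omit [Module.Free R (Alg Y)] [Module.Finite R (Alg Y)] in
/-- **`(1)^D = 1`: the Cartier dual of the trivial homomorphism `X → Y` is the trivial homomorphism `Y^D → X^D`** (on points: the character
pulled back along the trivial map is the trivial character; ★ `coord_injective`, ★ `coord_comp_cartierDualMap`, ★ `coord_one_eq`).
[cite: Tate1997FiniteFlatGroupSchemes, §(3.8) p. 145] -/
theorem cartierDualMap_one [IsMonHom (1 : X ⟶ Y)] : cartierDualMap (1 : X ⟶ Y) = 1 := by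
  apply coord_injective
  have h1 : coord (1 : cartierDual Y ⟶ cartierDual X) = (1 : WithConv (DualAlg X →ₐ[R] Alg (cartierDual Y))).ofConv :=
    coord_one_eq R (DualAlg X)
  rw [h1, ← Category.id_comp (cartierDualMap _), coord_comp_cartierDualMap, DualAlg.transpose_one, ← AlgHom.comp_assoc, AlgHom.convOne_def,
    WithConv.ofConv_toConv]
  congr 1
  exact Subsingleton.elim _ _

end One

/-! ## §1 `H^⊥` is a finite commutative group scheme -/

section Perp

variable {R : Type u} [CommRing R] {H G : SchemeOver R}
  [GrpObj H] [IsCommMonObj H] [IsAffine H.left] [Module.Free R (Alg H)] [Module.Finite R (Alg H)]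
  [GrpObj G] [IsCommMonObj G] [IsAffine G.left] [Module.Free R (Alg G)] [Module.Finite R (Alg G)]
  (j : H ⟶ G) [IsMonHom j]

/-- **`H^⊥` is COMMUTATIVE** (a kernel inside the commutative `G^D`, §0a). [cite: Tate1997FiniteFlatGroupSchemes, §(3.8) p. 146] -/
theorem isCommMonObj_annihilator : IsCommMonObj (annihilator j) :=
  isCommMonObj_ker (cartierDualMap j)

/-- **`H^⊥ → Spec R` is FINITE** (a closed subscheme of the finite `G^D`). [cite: Tate1997FiniteFlatGroupSchemes, §(3.8) p. 146] -/
theorem isFinite_annihilator_hom : IsFinite (annihilator j).hom := by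
  haveI := isClosedImmersion_annihilatorι_left j
  rw [← Over.w (annihilatorι j)]
  infer_instance

/-- `Γ(H^⊥)` is a finite `R`-module (★ `Alg.moduleFinite`). [cite: Tate1997FiniteFlatGroupSchemes, §(3.8) p. 146] -/
theorem finite_alg_annihilator : Module.Finite R (Alg (annihilator j)) :=
  haveI := isFinite_annihilator_hom j
  Alg.moduleFinite (annihilator j)

end Perp

/-! ## §2 The comparison homomorphism `H → (H^⊥)^⊥` over `G ≅ (G^D)^D` (over a field) -/

section Field

variable {k : Type u} [Field k] {H G : SchemeOver k}
  [GrpObj H] [IsCommMonObj H] [IsAffine H.left] [Module.Finite k (Alg H)]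
  [GrpObj G] [IsCommMonObj G] [IsAffine G.left] [Module.Finite k (Alg G)]
  (j : H ⟶ G) [IsMonHom j]

/- The nested annihilator `(H^⊥)^⊥ = annihilator (annihilatorι j)` needs `H^⊥` as a finite commutative affine group scheme; the three §1 facts
are supplied IN THE STATEMENTS by `haveI` (no instance is declared in this file). -/

/-- **`(j ≫ ε_G⁻¹) ≫ (ι_{H^⊥})^D = 1`**: by naturality of biduality `j ≫ ε_G⁻¹ = ε_H⁻¹ ≫ (j^D)^D` (★ p845987), and
`(j^D)^D ≫ (ι_{H^⊥})^D = (ι_{H^⊥} ≫ j^D)^D = (1)^D = 1` (★ `cartierDualMap_comp`, ★ `annihilatorι_comp`, §0b). [cite: Tate1997FiniteFlatGroupSchemes, §(3.8) p. 146] -/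
theorem comp_cartierDualBidualIso_inv_comp_cartierDualMap_annihilatorι :
    haveI := isCommMonObj_annihilator j
    haveI := isAffine_annihilator_left j
    haveI := finite_alg_annihilator j
    (j ≫ (cartierDualBidualIso G).inv) ≫ cartierDualMap (annihilatorι j) = 1 := by
  haveI : IsCommMonObj (annihilator j) := isCommMonObj_annihilator j
  haveI : IsAffine (annihilator j).left := isAffine_annihilator_left j
  haveI : Module.Finite k (Alg (annihilator j)) := finite_alg_annihilator j
  haveI : IsMonHom (1 : annihilator j ⟶ cartierDual H) := isMonHom_one
  rw [← cartierDualBidualIso_inv_comp_cartierDualMap_cartierDualMap, Category.assoc, ← cartierDualMap_comp,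
    cartierDualMap_congr (annihilatorι_comp j), cartierDualMap_one, MonObj.comp_one]

/-- **The comparison homomorphism `H → (H^⊥)^⊥`** over `G ≅ (G^D)^D`: a homomorphism `u` with `u ≫ ι_{(H^⊥)^⊥} = j ≫ ε_G⁻¹` (★ `kerLift`).
[cite: Tate1997FiniteFlatGroupSchemes, §(3.8) p. 146] -/
theorem exists_comp_annihilatorι_annihilatorι_eq :
    haveI := isCommMonObj_annihilator j
    haveI := isAffine_annihilator_left j
    haveI := finite_alg_annihilator j
    ∃ u : H ⟶ annihilator (annihilatorι j), IsMonHom u ∧ u ≫ annihilatorι (annihilatorι j) = j ≫ (cartierDualBidualIso G).inv := by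
  haveI : IsCommMonObj (annihilator j) := isCommMonObj_annihilator j
  haveI : IsAffine (annihilator j).left := isAffine_annihilator_left j
  haveI : Module.Finite k (Alg (annihilator j)) := finite_alg_annihilator j
  haveI := isMonHom_cartierDualBidualIso_hom G
  refine ⟨kerLift (j ≫ (cartierDualBidualIso G).inv) (comp_cartierDualBidualIso_inv_comp_cartierDualMap_annihilatorι j), ?_, kerLift_ι _ _⟩
  exact isMonHom_kerLift (f := cartierDualMap (annihilatorι j)) (j ≫ (cartierDualBidualIso G).inv) _

/-! ## §3 `(H^⊥)^⊥ = ε_G⁻¹(H)` for a closed subgroup -/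

variable [IsClosedImmersion j.left]

/-- **`rk Γ((H^⊥)^⊥) = rk Γ(H)`** (★ rank clause twice: `rk (H^⊥)^⊥ · rk H^⊥ = rk G^D = rk G = rk H^⊥ · rk H`).
[cite: Tate1997FiniteFlatGroupSchemes, §(3.8) p. 145] -/
theorem finrank_alg_annihilator_annihilatorι :
    haveI := isCommMonObj_annihilator j
    haveI := isAffine_annihilator_left j
    haveI := finite_alg_annihilator j
    Module.finrank k (Alg (annihilator (annihilatorι j))) = Module.finrank k (Alg H) := by
  haveI : IsCommMonObj (annihilator j) := isCommMonObj_annihilator j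
  haveI : IsAffine (annihilator j).left := isAffine_annihilator_left j
  haveI : Module.Finite k (Alg (annihilator j)) := finite_alg_annihilator j
  haveI := isClosedImmersion_annihilatorι_left j
  have h1 := finrank_alg_annihilator_mul_finrank (annihilatorι j)
  have h2 := finrank_alg_annihilator_mul_finrank j
  have h3 := finrank_alg_cartierDual G
  have hb : 0 < Module.finrank k (Alg (annihilator j)) := finrank_alg_pos (H := annihilator j)
  refine Nat.eq_of_mul_eq_mul_right hb ?_
  calc Module.finrank k (Alg (annihilator (annihilatorι j))) * Module.finrank k (Alg (annihilator j))
        = Module.finrank k (Alg (cartierDual G)) := h1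
    _ = Module.finrank k (Alg G) := h3
    _ = Module.finrank k (Alg (annihilator j)) * Module.finrank k (Alg H) := h2.symm
    _ = Module.finrank k (Alg H) * Module.finrank k (Alg (annihilator j)) := mul_comm _ _

set_option maxHeartbeats 400000 in
/-- **HEAD — THE DOUBLE ANNIHILATOR: `(H^⊥)^⊥ = ε_G⁻¹(H)`.**  For a closed subgroup `j : H ↪ G` of a finite commutative group scheme over a field,
the comparison homomorphism `H → (H^⊥)^⊥` over the bidual isomorphism `G ≅ (G^D)^D` is an ISOMORPHISM of group schemes: both are closed subschemes
of the affine `(G^D)^D`, one inside the other, of the same rank (§3 `finrank_alg_annihilator_annihilatorι`), hence with the same ideal (★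
`isIso_of_ker_appTop_eq`).  (Heartbeat budget 400000: instance bookkeeping of the nested annihilator over the twice-dualised carrier.)
[cite: Tate1997FiniteFlatGroupSchemes, §(3.8) pp. 145–146] [cite: GortzWedhorn2020, Definition 4.45 (2), p. 117] -/
theorem exists_iso_annihilator_annihilatorι :
    haveI := isCommMonObj_annihilator j
    haveI := isAffine_annihilator_left j
    haveI := finite_alg_annihilator j
    ∃ u : H ≅ annihilator (annihilatorι j), IsMonHom u.hom ∧ u.hom ≫ annihilatorι (annihilatorι j) = j ≫ (cartierDualBidualIso G).inv := by
  haveI : IsCommMonObj (annihilator j) := isCommMonObj_annihilator j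
  haveI : IsAffine (annihilator j).left := isAffine_annihilator_left j
  haveI : Module.Finite k (Alg (annihilator j)) := finite_alg_annihilator j
  obtain ⟨u, hu, hfac⟩ := exists_comp_annihilatorι_annihilatorι_eq j
  haveI := isClosedImmersion_annihilatorι_left (annihilatorι j)
  -- `c₁ := j ≫ ε⁻¹ : H ↪ (G^D)^D` is a closed immersion
  haveI : IsClosedImmersion (j ≫ (cartierDualBidualIso G).inv).left := by
    rw [Over.comp_left]
    infer_instance
  -- the two ideals `I₁ = ker Γ(c₁)`, `I₂ = ker Γ(ι_{⊥⊥})` of `A = Γ((G^D)^D)`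
  obtain ⟨I₁, hI₁⟩ : ∃ I : Ideal (Alg (cartierDual (cartierDual G))), I = RingHom.ker (j ≫ (cartierDualBidualIso G).inv).left.appTop.hom :=
    ⟨_, rfl⟩
  obtain ⟨I₂, hI₂⟩ : ∃ I : Ideal (Alg (cartierDual (cartierDual G))), I = RingHom.ker (annihilatorι (annihilatorι j)).left.appTop.hom :=
    ⟨_, rfl⟩
  -- `I₂ ≤ I₁` from the factorisation `u ≫ ι_{⊥⊥} = c₁`
  have hle : I₂.restrictScalars k ≤ I₁.restrictScalars k := by
    intro a ha
    have ha' : (annihilatorι (annihilatorι j)).left.appTop.hom a = 0 := by rw [← RingHom.mem_ker, ← hI₂]; exact ha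
    have goal : (j ≫ (cartierDualBidualIso G).inv).left.appTop.hom a = 0 := by
      rw [← hfac, Over.comp_left, Scheme.Hom.comp_appTop]
      change u.left.appTop.hom ((annihilatorι (annihilatorι j)).left.appTop.hom a) = 0
      rw [ha', map_zero]
    have : a ∈ I₁ := by rw [hI₁, RingHom.mem_ker]; exact goal
    exact this
  -- equal ranks of the quotients `A ⧸ I₁ ≅ Γ(H)`, `A ⧸ I₂ ≅ Γ((H^⊥)^⊥)`, hence of the ideals
  have q1 : Module.finrank k (Alg (cartierDual (cartierDual G)) ⧸ I₁) = Module.finrank k (Alg H) := by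
    rw [hI₁]; exact (finrank_alg_eq_finrank_quotient_ker _).symm
  have q2' : Module.finrank k (Alg (cartierDual (cartierDual G)) ⧸ I₂) = Module.finrank k (Alg (annihilator (annihilatorι j))) := by
    rw [hI₂]; exact (finrank_alg_eq_finrank_quotient_ker _).symm
  have q2 : Module.finrank k (Alg (cartierDual (cartierDual G)) ⧸ I₂) = Module.finrank k (Alg H) :=
    q2'.trans (finrank_alg_annihilator_annihilatorι j)
  have a1 := Submodule.finrank_quotient_add_finrank (I₁.restrictScalars k)
  have a2 := Submodule.finrank_quotient_add_finrank (I₂.restrictScalars k)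
  have r1 : Module.finrank k (Alg (cartierDual (cartierDual G)) ⧸ I₁.restrictScalars k) = Module.finrank k (Alg H) := q1
  have r2 : Module.finrank k (Alg (cartierDual (cartierDual G)) ⧸ I₂.restrictScalars k) = Module.finrank k (Alg H) := q2
  have hK : I₂.restrictScalars k = I₁.restrictScalars k := Submodule.eq_of_le_of_finrank_le hle (by omega)
  have heq : RingHom.ker (j ≫ (cartierDualBidualIso G).inv).left.appTop.hom =
      RingHom.ker (annihilatorι (annihilatorι j)).left.appTop.hom := by
    rw [← hI₁, ← hI₂]
    exact (Submodule.restrictScalars_injective k _ _ hK).symm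
  haveI : IsIso u := isIso_of_ker_appTop_eq _ _ u hfac heq
  exact ⟨asIso u, hu, hfac⟩

end Field

end AffineGroupScheme

end Literature.AlgebraicGeometry.GroupSchemes

end
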